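import Summits.QuantumFields.YangMills.Theorems.BalabanUVNodesN20ClassLawConditionalHybridBound

/-!
# BalabanUVNodes ∕ N20·N19′·N21 — THE CHAIN RULE FOR THE CLASS-LAW ℓ¹ DISTANCE UNDER ONE COARSENING OF THE KEY (FILE U): for ANY key map `π` on the classes, the two runs' class laws
# are ℓ¹-close at the FINE key by their ℓ¹ distance at the COARSE key PLUS the mass-weighted gap of the two runs' CONDITIONAL laws inside each coarse class —
# `Σ_τ |P τ − Q τ| ≤ Σ_c |P_c − Q_c| + Σ_τ |P τ·Q_{πτ} − Q τ·P_{πτ}| ∕ Q_{πτ}` — the one-dial step that FILE T iterated over blocks, for arbitrary partitions (dag-n20-d's key-reading dials compose)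

Cell `pub-ymgap` (HUMAN RULING D-0062 Track A; work-bound push D-0149, director-ym №197), width seat `pub-ymgap-dag-n20-w1` (gen 7) on node N20 = NE7b; key item of this
seat's payload K3⁷ `SpineGivenEndpointR13SepCoPH` = stmt-QuantumFields-20544 (ASIDE; lineage of K3⁸ `SpineGivenEndpointR13SepCoPHV` = stmt-QuantumFields-27366, skeleton v6
b4e55110ab73e679 UNTOUCHED; `--kind proof --supports 20544 --as helper`, MIS-KEY rule R463 (4)(a)); COUNT-NEUTRAL.  Bus: CLAIM-25 ∕ INTENT-30.
THEOREMS ONLY (0 def ∕ instance ∕ notation ∕ sorry); imports this seat's FILE T `…N20ClassLawConditionalHybridBound` (through it dag-n20-w4 p609004 and FILE A, BY NAME).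

WHY.  FILE T ran the chain rule for total variation along the filtration «one block at a time» (binary refinements of the large-field configuration).  At the record the dials of
stub 2 are KEY READINGS (dag-n20-d's kit: `crOfRecord₁₃KAt kr bd sh`, the level window `windowKey`, the component-forgiving key, the tower `…KTower` — «dials compose»): a coarser
key is a MAP `π` on the classes of a finer one, the coarse class weights are the FIBRE SUMS, and a tower of keys is a chain of such maps with arbitrary (not binary) fibres.  This
file is the one-step chain rule at that generality, mass-weighted and division-free in its hypotheses: for non-negative weights `P, Q` on the fine classes `T` and ANY map `π`,
with coarse weights `P_c = Σ_{πτ = c} P τ`, ★★★ `l1_le_l1_image_add_condGap` — `Σ_{τ∈T} |P τ − Q τ| ≤ Σ_{c ∈ π(T)} |P_c − Q_c| + Σ_{τ∈T} |P τ·Q_{πτ} − Q τ·P_{πτ}| ∕ Q_{πτ}`; the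
second term is `Σ_c P_c · Σ_{τ ∈ c} |P(τ|c) − Q(τ|c)|`, the `P`-AVERAGED ℓ¹ distance of the two runs' CONDITIONAL laws inside the coarse classes (per fibre, §1
`fibre_l1_le_abs_sub_add_condGap`; a fibre of `Q`-mass zero costs nothing beyond its coarse gap — Lean's `x ∕ 0 = 0` makes the statement exact there).  Uniform form ★★
`l1_le_l1_image_add_of_condDiscrepancy`: if inside every coarse class the conditional laws are `ε`-close in the division-free sense `Σ_{τ∈c}|P τ·Q_c − Q τ·P_c| ≤ ε·P_c·Q_c`, the
fine ℓ¹ distance exceeds the coarse one by at most `ε·Σ_T P`.  §2 reads it in the tree's class-law currency along `K`: ★★ `classLawGap_fine_le_coarse_add` — at every `(K, t)` every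
class-set gap of the normalised laws at the FINE key is at most `ρ^c_K + γ_K` where `ρ^c_K` bounds HALF the coarse normalised ℓ¹ distance and `γ_K` HALF the averaged conditional
term; so (★★★ `exists_hybridNE7_of_target_of_coarseTV_and_condGap`) node U5's `Target` + a summable coarse-key class-law ℓ¹ letter + a summable within-class conditional letter,
`ρ^c_K + γ_K < 1`, give `HybridNE7` at the FINE key with NO bad class (dag-n20-w4's road BY NAME).  ITERATION over a tower of keys is one application per dial step (the coarse
letter of step `j+1` is the conclusion of step `j`; at the trivial key the coarse ℓ¹ distance of normalised laws is `0`).  COMPANION (the other direction, data processing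
«coarse ≤ fine»): dag-n20-w4 g2 `…N20ClassLawTVCoarsening` (`abs_pushClassLaw_sub_le_of_classLaw`, `exists_hybridNE7_push_of_target_of_classLawTV`) — same fibre-sum spelling
`k ↦ Σ_{τ ∈ T, f τ = k} A τ`; together: coarse ℓ¹ ≤ fine ℓ¹ ≤ coarse ℓ¹ + the conditional term.
LOCATED READING (hypothesis SHAPES; for the plan's window key and dag-n20-d's dial kit): the class-law half of stub 2 at ANY key reached from the trivial key by a finite chain of
refinements costs EXACTLY the sum over the refinement steps of the two runs' mass-weighted CONDITIONAL-law discrepancies inside the classes being refined — e.g. trivial key →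
level window of width 1 → width 2 → … → `wkey`: per step, «given the large-field structure of the coarser levels, the two runs' conditional laws of the next level's structure are
ℓ¹-close on average», summably in `K`.  Nothing of Bałaban's is claimed to supply these letters.

HONEST FRAMING.  [folklore] finite-sum probability (chain rule ∕ data-processing bookkeeping for total variation under a partition map) on hypothesis SHAPES; nothing read at the
record (`classSet₁₃ ∕ weightA₁₃ ∕ weightB₁₃` untouched; (LS)∕(XG′)∕(SAT′) and the regime AT THE RECORD UNDECIDED); proves NO estimate of Bałaban's; refutes NO registered stub; nothing of
Bałaban's asserted or instantiated.  NE7 ∕ NE7b ∕ NE7c NOT PRINTED for `d = 4`, NOT proved; N19 ∕ N20 ∕ N21 NOT discharged; K3⁸ ∕ K3⁷ OPEN; counts unmoved (typed 28∕28 · discharged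
5∕27); no count claim.  One finite `𝕋⁴_{L^K}` programme at fixed `ε = L^{−K}`, Bałaban AS PRINTED; the YM mass gap (Clay) is NOT proved by any of this — R4 closes the conditional
finite-𝕋⁴ rung `BalabanLadder.UV` only; NOT ℝ⁴, NOT OS.  No decl carries a cite tag.
-/

noncomputable section

open Finset
open Literature.MathematicalPhysics.QuantumFieldTheory.Balaban1983to89
open Literature.MathematicalPhysics.QuantumFieldTheory.Balaban1983to89.T4MatchingAssembly (HybridNE7)
open Summit.QuantumFields.BalabanUV.T4Continuum.Spine.NE7 (Target)
open Summit.QuantumFields.YangMills.BalabanUVNodes.N20BlockCaricatureAffinity (abs_sub_le_half_sum_abs)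
open Summit.QuantumFields.YangMills.BalabanUVNodes.N20HybridClassLawCharacterisation (exists_hybridNE7_of_target_of_classLawTV)

namespace Summit.QuantumFields.YangMills.BalabanUVNodes.N20ClassLawCoarseningChainRule

/-! ## §1 One coarsening step, any partition -/

section OneStep

variable {ι κ : Type*} [DecidableEq κ]

/-- **PER FIBRE** [folklore]: non-negative `P, Q` on a finite set `s` with totals `X = Σ_s P`, `Y = Σ_s Q` satisfy `Σ_s |P − Q| ≤ |X − Y| + Σ_s |P·Y − Q·X| ∕ Y` — the second term is
`X·Σ_s |P∕X − Q∕Y|`, the `X`-weighted ℓ¹ distance of the two CONDITIONAL laws on the fibre (`= 0` when `Y = 0`, where the bound reads `X ≤ X`). -/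
theorem fibre_l1_le_abs_sub_add_condGap (s : Finset ι) {P Q : ι → ℝ} (hP : ∀ τ ∈ s, 0 ≤ P τ) (hQ : ∀ τ ∈ s, 0 ≤ Q τ) :
    ∑ τ ∈ s, |P τ - Q τ| ≤ |∑ τ ∈ s, P τ - ∑ τ ∈ s, Q τ| + ∑ τ ∈ s, |P τ * ∑ σ ∈ s, Q σ - Q τ * ∑ σ ∈ s, P σ| / ∑ σ ∈ s, Q σ := by
  rcases (Finset.sum_nonneg hQ).eq_or_lt with hY0 | hYpos
  · -- `Q ≡ 0` on the fibre: the bound reads `X ≤ X + 0`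
    have hQ0 : ∀ τ ∈ s, Q τ = 0 := fun τ hτ => le_antisymm (by rw [hY0]; exact Finset.single_le_sum hQ hτ) (hQ τ hτ)
    have e1 : ∑ τ ∈ s, |P τ - Q τ| = ∑ τ ∈ s, P τ := Finset.sum_congr rfl fun τ hτ => by rw [hQ0 τ hτ, sub_zero, abs_of_nonneg (hP τ hτ)]
    rw [e1, ← hY0, sub_zero, abs_of_nonneg (Finset.sum_nonneg hP)]
    simp
  · have key : ∀ τ ∈ s, |P τ - Q τ| ≤ Q τ / (∑ σ ∈ s, Q σ) * |∑ σ ∈ s, P σ - ∑ σ ∈ s, Q σ| +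
        |P τ * ∑ σ ∈ s, Q σ - Q τ * ∑ σ ∈ s, P σ| / ∑ σ ∈ s, Q σ := fun τ hτ => by
      have e : P τ - Q τ = Q τ / (∑ σ ∈ s, Q σ) * (∑ σ ∈ s, P σ - ∑ σ ∈ s, Q σ) + (P τ * ∑ σ ∈ s, Q σ - Q τ * ∑ σ ∈ s, P σ) / ∑ σ ∈ s, Q σ := by
        field_simp; ring
      rw [e]
      calc |Q τ / (∑ σ ∈ s, Q σ) * (∑ σ ∈ s, P σ - ∑ σ ∈ s, Q σ) + (P τ * ∑ σ ∈ s, Q σ - Q τ * ∑ σ ∈ s, P σ) / ∑ σ ∈ s, Q σ|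
          ≤ |Q τ / (∑ σ ∈ s, Q σ) * (∑ σ ∈ s, P σ - ∑ σ ∈ s, Q σ)| + |(P τ * ∑ σ ∈ s, Q σ - Q τ * ∑ σ ∈ s, P σ) / ∑ σ ∈ s, Q σ| := abs_add_le _ _
        _ = Q τ / (∑ σ ∈ s, Q σ) * |∑ σ ∈ s, P σ - ∑ σ ∈ s, Q σ| + |P τ * ∑ σ ∈ s, Q σ - Q τ * ∑ σ ∈ s, P σ| / ∑ σ ∈ s, Q σ := by
            rw [abs_mul, abs_of_nonneg (div_nonneg (hQ τ hτ) hYpos.le), abs_div, abs_of_pos hYpos]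
    refine (Finset.sum_le_sum key).trans (le_of_eq ?_)
    rw [Finset.sum_add_distrib, ← Finset.sum_mul, ← Finset.sum_div, div_self hYpos.ne', one_mul]

/-- ★★★ **THE CHAIN RULE UNDER ONE COARSENING, MASS-WEIGHTED** [folklore]: fine classes `T`, ANY key map `π`, non-negative weights `P, Q`; with the coarse (fibre-sum) weights
`P_c = Σ_{τ∈T, πτ=c} P τ`: `Σ_{τ∈T} |P τ − Q τ| ≤ Σ_{c ∈ π(T)} |P_c − Q_c| + Σ_{τ∈T} |P τ·Q_{πτ} − Q τ·P_{πτ}| ∕ Q_{πτ}` — the fine ℓ¹ distance is the coarse one plus the `P`-averaged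
ℓ¹ distance of the two runs' CONDITIONAL laws inside the coarse classes.  NO independence, NO structure on `π`. -/
theorem l1_le_l1_image_add_condGap (T : Finset ι) (π : ι → κ) {P Q : ι → ℝ} (hP : ∀ τ ∈ T, 0 ≤ P τ) (hQ : ∀ τ ∈ T, 0 ≤ Q τ) :
    ∑ τ ∈ T, |P τ - Q τ| ≤
      ∑ c ∈ T.image π, |∑ τ ∈ T.filter (fun τ => π τ = c), P τ - ∑ τ ∈ T.filter (fun τ => π τ = c), Q τ| +
        ∑ τ ∈ T, |P τ * ∑ σ ∈ T.filter (fun σ => π σ = π τ), Q σ - Q τ * ∑ σ ∈ T.filter (fun σ => π σ = π τ), P σ| /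
          ∑ σ ∈ T.filter (fun σ => π σ = π τ), Q σ := by
  have hmaps : ∀ τ ∈ T, π τ ∈ T.image π := fun τ hτ => Finset.mem_image_of_mem π hτ
  rw [← Finset.sum_fiberwise_of_maps_to hmaps (fun τ => |P τ - Q τ|),
    ← Finset.sum_fiberwise_of_maps_to hmaps (fun τ => |P τ * ∑ σ ∈ T.filter (fun σ => π σ = π τ), Q σ - Q τ * ∑ σ ∈ T.filter (fun σ => π σ = π τ), P σ| /
      ∑ σ ∈ T.filter (fun σ => π σ = π τ), Q σ), ← Finset.sum_add_distrib]
  refine Finset.sum_le_sum fun c _ => ?_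
  have hfib := fibre_l1_le_abs_sub_add_condGap (T.filter (fun τ => π τ = c)) (P := P) (Q := Q)
    (fun τ hτ => hP τ (Finset.mem_filter.1 hτ).1) (fun τ hτ => hQ τ (Finset.mem_filter.1 hτ).1)
  refine hfib.trans (le_of_eq ?_)
  congr 1
  exact Finset.sum_congr rfl fun τ hτ => by rw [(Finset.mem_filter.1 hτ).2]

/-- ★★ **UNIFORM FORM** [folklore]: if inside EVERY coarse class the two conditional laws are `ε`-close in the division-free sense `Σ_{τ∈c} |P τ·Q_c − Q τ·P_c| ≤ ε·P_c·Q_c`, then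
`Σ_T |P − Q| ≤ Σ_c |P_c − Q_c| + ε·Σ_T P`. -/
theorem l1_le_l1_image_add_of_condDiscrepancy (T : Finset ι) (π : ι → κ) {P Q : ι → ℝ} (hP : ∀ τ ∈ T, 0 ≤ P τ) (hQ : ∀ τ ∈ T, 0 ≤ Q τ) {ε : ℝ} (hε : 0 ≤ ε)
    (hcond : ∀ c ∈ T.image π, ∑ τ ∈ T.filter (fun τ => π τ = c), |P τ * ∑ σ ∈ T.filter (fun σ => π σ = c), Q σ - Q τ * ∑ σ ∈ T.filter (fun σ => π σ = c), P σ| ≤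
      ε * ((∑ σ ∈ T.filter (fun σ => π σ = c), P σ) * ∑ σ ∈ T.filter (fun σ => π σ = c), Q σ)) :
    ∑ τ ∈ T, |P τ - Q τ| ≤ ∑ c ∈ T.image π, |∑ τ ∈ T.filter (fun τ => π τ = c), P τ - ∑ τ ∈ T.filter (fun τ => π τ = c), Q τ| + ε * ∑ τ ∈ T, P τ := by
  refine (l1_le_l1_image_add_condGap T π hP hQ).trans (add_le_add_right ?_ _)
  have hmaps : ∀ τ ∈ T, π τ ∈ T.image π := fun τ hτ => Finset.mem_image_of_mem π hτ
  rw [← Finset.sum_fiberwise_of_maps_to hmaps (fun τ => |P τ * ∑ σ ∈ T.filter (fun σ => π σ = π τ), Q σ - Q τ * ∑ σ ∈ T.filter (fun σ => π σ = π τ), P σ| /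
      ∑ σ ∈ T.filter (fun σ => π σ = π τ), Q σ), ← Finset.sum_fiberwise_of_maps_to hmaps P, Finset.mul_sum]
  refine Finset.sum_le_sum fun c hc => ?_
  -- inside the fibre of `c` every `π τ` is `c`
  have e : ∀ f : ι → ℝ, ∑ τ ∈ T.filter (fun τ => π τ = c), f τ / ∑ σ ∈ T.filter (fun σ => π σ = π τ), Q σ =
      (∑ τ ∈ T.filter (fun τ => π τ = c), f τ) / ∑ σ ∈ T.filter (fun σ => π σ = c), Q σ := fun f => by
    rw [Finset.sum_div]; exact Finset.sum_congr rfl fun τ hτ => by rw [(Finset.mem_filter.1 hτ).2]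
  have e' : ∑ τ ∈ T.filter (fun τ => π τ = c), |P τ * ∑ σ ∈ T.filter (fun σ => π σ = π τ), Q σ - Q τ * ∑ σ ∈ T.filter (fun σ => π σ = π τ), P σ| /
        ∑ σ ∈ T.filter (fun σ => π σ = π τ), Q σ =
      (∑ τ ∈ T.filter (fun τ => π τ = c), |P τ * ∑ σ ∈ T.filter (fun σ => π σ = c), Q σ - Q τ * ∑ σ ∈ T.filter (fun σ => π σ = c), P σ|) /
        ∑ σ ∈ T.filter (fun σ => π σ = c), Q σ := by
    rw [Finset.sum_div]; exact Finset.sum_congr rfl fun τ hτ => by rw [(Finset.mem_filter.1 hτ).2]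
  rw [e']
  have hPc : 0 ≤ ∑ σ ∈ T.filter (fun σ => π σ = c), P σ := Finset.sum_nonneg fun σ hσ => hP σ (Finset.mem_filter.1 hσ).1
  rcases (Finset.sum_nonneg fun σ hσ => hQ σ (Finset.mem_filter.1 hσ).1 : 0 ≤ ∑ σ ∈ T.filter (fun σ => π σ = c), Q σ).eq_or_lt with hQ0 | hQpos
  · rw [← hQ0, div_zero]; exact mul_nonneg hε hPc
  · rw [div_le_iff₀ hQpos]; nlinarith [hcond c hc]

end OneStep

/-! ## §2 Along `K`, in the tree's class-law currency: FINE radius ≤ COARSE radius + conditional term; `HybridNE7` from node U5's target -/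

section AlongK

variable {ι κ : Type*} [DecidableEq ι] [DecidableEq κ] {l₀ vol : ℝ} (T : ℕ → Finset ι) (A B : ℕ → ℝ → ι → ℝ) (π : ℕ → ι → κ) (ρc γ : ℕ → ℝ)

omit [DecidableEq ι] in
/-- ★★ **FINE CLASS-SET GAPS FROM THE COARSE ℓ¹ LETTER AND THE CONDITIONAL LETTER** [folklore ∕ bookkeeping]: class weights `A_K(t,·), B_K(t,·) ≥ 0` on `T K` with positive totals, a key
map `π_K` per scale; if at every `|t| ≤ l₀` HALF the ℓ¹ distance of the NORMALISED laws pushed to the coarse key is `≤ ρc_K` and HALF the normalised conditional term is `≤ γ_K`, then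
every class-set gap of the normalised laws at the fine key is `≤ ρc_K + γ_K`. -/
theorem classLawGap_fine_le_coarse_add
    (hA : ∀ (K : ℕ) (t : ℝ), |t| ≤ l₀ → ∀ τ ∈ T K, 0 ≤ A K t τ) (hB : ∀ (K : ℕ) (t : ℝ), |t| ≤ l₀ → ∀ τ ∈ T K, 0 ≤ B K t τ)
    (hZA : ∀ (K : ℕ) (t : ℝ), |t| ≤ l₀ → 0 < ∑ τ ∈ T K, A K t τ) (hZB : ∀ (K : ℕ) (t : ℝ), |t| ≤ l₀ → 0 < ∑ τ ∈ T K, B K t τ)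
    (hcoarse : ∀ (K : ℕ) (t : ℝ), |t| ≤ l₀ →
      ∑ c ∈ (T K).image (π K), |(∑ τ ∈ (T K).filter (fun τ => π K τ = c), A K t τ) / (∑ τ ∈ T K, A K t τ) -
        (∑ τ ∈ (T K).filter (fun τ => π K τ = c), B K t τ) / (∑ τ ∈ T K, B K t τ)| ≤ 2 * ρc K)
    (hcond : ∀ (K : ℕ) (t : ℝ), |t| ≤ l₀ →
      ∑ τ ∈ T K, |A K t τ / (∑ σ ∈ T K, A K t σ) * ((∑ σ ∈ (T K).filter (fun σ => π K σ = π K τ), B K t σ) / ∑ σ ∈ T K, B K t σ) -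
          B K t τ / (∑ σ ∈ T K, B K t σ) * ((∑ σ ∈ (T K).filter (fun σ => π K σ = π K τ), A K t σ) / ∑ σ ∈ T K, A K t σ)| /
        ((∑ σ ∈ (T K).filter (fun σ => π K σ = π K τ), B K t σ) / ∑ σ ∈ T K, B K t σ) ≤ 2 * γ K)
    (K : ℕ) (t : ℝ) (ht : |t| ≤ l₀) (𝒮 : Finset ι) (h𝒮 : 𝒮 ⊆ T K) :
    |(∑ τ ∈ 𝒮, A K t τ) / (∑ τ ∈ T K, A K t τ) - (∑ τ ∈ 𝒮, B K t τ) / (∑ τ ∈ T K, B K t τ)| ≤ ρc K + γ K := by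
  set ZA := ∑ τ ∈ T K, A K t τ with hZAd
  set ZB := ∑ τ ∈ T K, B K t τ with hZBd
  have hZA' := hZA K t ht
  have hZB' := hZB K t ht
  -- the normalised laws
  set P : ι → ℝ := fun τ => A K t τ / ZA with hPd
  set Q : ι → ℝ := fun τ => B K t τ / ZB with hQd
  have hP : ∀ τ ∈ T K, 0 ≤ P τ := fun τ hτ => div_nonneg (hA K t ht τ hτ) hZA'.le
  have hQ : ∀ τ ∈ T K, 0 ≤ Q τ := fun τ hτ => div_nonneg (hB K t ht τ hτ) hZB'.le
  have hPtot : ∑ τ ∈ T K, P τ = 1 := by rw [hPd]; simp only; rw [← Finset.sum_div, div_self hZA'.ne']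
  have hQtot : ∑ τ ∈ T K, Q τ = 1 := by rw [hQd]; simp only; rw [← Finset.sum_div, div_self hZB'.ne']
  have hchain := l1_le_l1_image_add_condGap (T K) (π K) hP hQ
  -- rewrite the fibre sums of the normalised laws as normalised fibre sums
  have eP : ∀ s : Finset ι, ∑ τ ∈ s, P τ = (∑ τ ∈ s, A K t τ) / ZA := fun s => by rw [hPd]; simp only; rw [Finset.sum_div]
  have eQ : ∀ s : Finset ι, ∑ τ ∈ s, Q τ = (∑ τ ∈ s, B K t τ) / ZB := fun s => by rw [hQd]; simp only; rw [Finset.sum_div]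
  simp only [eP, eQ] at hchain
  have hc := hcoarse K t ht
  have hγ := hcond K t ht
  have hhalf := abs_sub_le_half_sum_abs (T K) (a := P) (b := Q) (hPtot.trans hQtot.symm) h𝒮
  rw [eP, eQ] at hhalf
  have hl1 : ∑ τ ∈ T K, |Q τ - P τ| = ∑ τ ∈ T K, |P τ - Q τ| := Finset.sum_congr rfl fun τ _ => abs_sub_comm _ _
  rw [hl1] at hhalf
  rw [abs_sub_comm]
  have : ∑ τ ∈ T K, |P τ - Q τ| ≤ 2 * ρc K + 2 * γ K := by
    exact hchain.trans (add_le_add hc (by simpa [hPd, hQd] using hγ))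
  linarith

/-- ★★★ **`HybridNE7` AT THE FINE KEY FROM NODE U5's TARGET, A COARSE CLASS-LAW LETTER AND A CONDITIONAL LETTER** [folklore ∕ bookkeeping]: in the setting of
`classLawGap_fine_le_coarse_add`, with the E1∕E2 dictionary to `Z` and `Target vol l₀ δ Z`, `ρc, γ ≥ 0` summable with `ρc_K + γ_K < 1`: SOME shells give
`HybridNE7 l₀ vol T A B ∅ 0 shA shB (ρc + γ) δ` (dag-n20-w4's `exists_hybridNE7_of_target_of_classLawTV` BY NAME).  One DIAL STEP of a key tower; iterate per step. -/
theorem exists_hybridNE7_of_target_of_coarseTV_and_condGap (hl₀ : 0 ≤ l₀)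
    (hA : ∀ (K : ℕ) (t : ℝ), |t| ≤ l₀ → ∀ τ ∈ T K, 0 ≤ A K t τ) (hB : ∀ (K : ℕ) (t : ℝ), |t| ≤ l₀ → ∀ τ ∈ T K, 0 ≤ B K t τ)
    (hZA : ∀ (K : ℕ) (t : ℝ), |t| ≤ l₀ → 0 < ∑ τ ∈ T K, A K t τ) (hZB : ∀ (K : ℕ) (t : ℝ), |t| ≤ l₀ → 0 < ∑ τ ∈ T K, B K t τ)
    {Z : ℕ → ℝ → ℝ} (hZA' : ∀ (K : ℕ) (t : ℝ), |t| ≤ l₀ → Z K t = ∑ τ ∈ T K, A K t τ) (hZB' : ∀ (K : ℕ) (t : ℝ), |t| ≤ l₀ → Z (K + 1) t = ∑ τ ∈ T K, B K t τ)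
    {δ : ℕ → ℝ} (hT : Target vol l₀ δ Z) (hρc0 : ∀ K, 0 ≤ ρc K) (hγ0 : ∀ K, 0 ≤ γ K) (hlt : ∀ K, ρc K + γ K < 1) (hρcs : Summable ρc) (hγs : Summable γ)
    (hcoarse : ∀ (K : ℕ) (t : ℝ), |t| ≤ l₀ →
      ∑ c ∈ (T K).image (π K), |(∑ τ ∈ (T K).filter (fun τ => π K τ = c), A K t τ) / (∑ τ ∈ T K, A K t τ) -
        (∑ τ ∈ (T K).filter (fun τ => π K τ = c), B K t τ) / (∑ τ ∈ T K, B K t τ)| ≤ 2 * ρc K)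
    (hcond : ∀ (K : ℕ) (t : ℝ), |t| ≤ l₀ →
      ∑ τ ∈ T K, |A K t τ / (∑ σ ∈ T K, A K t σ) * ((∑ σ ∈ (T K).filter (fun σ => π K σ = π K τ), B K t σ) / ∑ σ ∈ T K, B K t σ) -
          B K t τ / (∑ σ ∈ T K, B K t σ) * ((∑ σ ∈ (T K).filter (fun σ => π K σ = π K τ), A K t σ) / ∑ σ ∈ T K, A K t σ)| /
        ((∑ σ ∈ (T K).filter (fun σ => π K σ = π K τ), B K t σ) / ∑ σ ∈ T K, B K t σ) ≤ 2 * γ K) :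
    ∃ shA shB : ℕ → ℝ → ι → ℝ, HybridNE7 l₀ vol T A B (fun _ _ => ∅) (fun _ => 0) shA shB (fun K => ρc K + γ K) δ :=
  exists_hybridNE7_of_target_of_classLawTV hl₀ hA hB hZA hZB hZA' hZB' hT (fun K => add_nonneg (hρc0 K) (hγ0 K)) hlt (hρcs.add hγs)
    (fun K t ht 𝒮 h𝒮 => classLawGap_fine_le_coarse_add T A B π ρc γ hA hB hZA hZB hcoarse hcond K t ht 𝒮 h𝒮)

end AlongK

end Summit.QuantumFields.YangMills.BalabanUVNodes.N20ClassLawCoarseningChainRule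

end
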